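import Summits.AtomisticToContinuum.HydrodynamicLimit.Theorems.CollisionIsometryCLTAdaptedWeightCLTBHDVTransfer
import Summits.AtomisticToContinuum.HydrodynamicLimit.Theorems.CollisionIsometryCLTAdaptedWeightCLTBHEntropyBudgetDerivBound

/-!
# Aggregate DV step (stub `stub_dvAggregate`, G2) for the line `block-h-dissipation-closure`
# (crux `AdaptedWeightCLT`, stmt-AtomisticToContinuum-14868), file 2: envelopes uniform in the location

Support file (`--supports stmt-AtomisticToContinuum-14868`, anchor `bhDVAggregate_envelope_anchor`) of the line
lead `prover-line-stmt-AtomisticToContinuum-14868-c4-0`, written for the registered stub `stub_dvAggregate`.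
The S2 worker's log-envelopes (`DVTransfer.abs_log_cellLaw_le`, `DVTransfer.exp_half_dLam_le`, the lower bound of
`contactDens` by one charged component) have constants depending on the location `x` through the cell velocity
`ū_x`, the cell temperature `θ̄_x` and the charged weight `ψ_N(x_a − x)`. Using S1's cell bounds (`|ū_x| ≤ V`,
`θ̄_x ≤ (2V)²/3` for speeds `≤ V`, `EntropyBudget.norm_cU_le`, `EntropyBudget.theta_le`) this file makes them
UNIFORM in `x`:

* `exists_abs_log_cellLaw_le` — `|log f̂_x(v)| ≤ Λ + ‖v‖²/h²` for all `x, v`; hence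
  `exists_abs_dLam_le` — `|ΔΛ_x(y)| ≤ Λ′ + Σ_m ‖y_m‖²/h²`;
* `exists_exp_half_dLam_le` — `e^{ΔΛ_x(y)/2} ≤ C · e^{α_x ‖y₁ − ū_x‖²} e^{α_x ‖y₂ − ū_x‖²}`, `α_x = 1/(4(θ̄_x + h²))`,
  with `C` independent of `x`;
* `gauss4_ge`, `contactDens_ge` — the smeared contact density is bounded BELOW by its mass times an explicit
  Gaussian of `y` (all contact quadruples of the window lie in a bounded set), `contactDens_pos`;
* `abs_log_contactDens_sub_log_contactMass_le` — `|log contactDens_x(y) − log contactMass_x| ≤ M + Σ_m ‖y_m‖²/h²`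
  on charged cell-windows, `M` independent of `x`.

No definitions.
-/

namespace Summit.AtomisticToContinuum.HydrodynamicLimit.Theorems.BlockHDissipation

open scoped BigOperators Topology Classical MeasureTheory ENNReal InnerProductSpace
open Filter Set MeasureTheory Real
open Literature.Analysis.FluidPDE
open Summit.AtomisticToContinuum.HydrodynamicLimit.Theorems.ContactSourceDuhamel (T3 V3 Cfg Vel Flow Flows)
open Literature.MathematicalPhysics.KineticTheory (hsDiameter collide hardSphereKernel sphereMeasure)

noncomputable section

namespace DVAggregate

variable {σ : ℝ} {N : ℕ} {ψ : ℕ → T3 → ℝ}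

/-! ## The regularised cell law -/

/-- Every speed of a configuration is bounded by the sum of all speeds. -/
theorem norm_vel_le_sum (w : Cfg N) (i : Fin (N + 1)) : ‖(w i).2‖ ≤ ∑ j, ‖(w j).2‖ :=
  Finset.single_le_sum (f := fun j => ‖(w j).2‖) (fun _ _ => norm_nonneg _) (Finset.mem_univ i)

/-- **Uniform log-envelope of the regularised cell law**: for a nonnegative kernel family, `0 < h`, `0 < δ ≤ 1` and
a configuration with speeds `≤ V` there is `Λ ≥ 0`, independent of the location, with `|log f̂_x(v)| ≤ Λ + ‖v‖²/h²`. -/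
theorem exists_abs_log_cellLaw_le (hψ : ∀ N y, 0 ≤ ψ N y) {h : ℝ} (hh : 0 < h) {δ : ℝ} (hδ0 : 0 < δ) (hδ1 : δ ≤ 1)
    (w : Cfg N) {V : ℝ} (hV : ∀ i, ‖(w i).2‖ ≤ V) :
    ∃ Λ : ℝ, 0 ≤ Λ ∧ ∀ (x : T3) (v : V3), |Real.log (cellLaw N ψ h δ w x v)| ≤ Λ + ‖v‖ ^ 2 / h ^ 2 := by
  refine ⟨|Real.log (gauss h (0 : V3) 0)| + |Real.log δ| + (Module.finrank ℝ V3 : ℝ) / 2 *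
      (|Real.log (2 * π * h ^ 2)| + |Real.log (2 * π * (h ^ 2 + (2 * V) ^ 2 / 3))|) + V ^ 2 / h ^ 2,
    by positivity, fun x v => ?_⟩
  have h0 := DVTransfer.abs_log_cellLaw_le hψ hh.ne' hδ0 hδ1 w x v
  have hτ : 0 < cT N ψ w x + h ^ 2 := EntropyBudget.theta_pos w x (hψ N) hh
  -- the prefactor, uniformly in the cell temperature
  have hpref : |Real.log ((2 * π * (cT N ψ w x + h ^ 2)) ^ (-(Module.finrank ℝ V3 : ℝ) / 2))| ≤
      (Module.finrank ℝ V3 : ℝ) / 2 *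
        (|Real.log (2 * π * h ^ 2)| + |Real.log (2 * π * (h ^ 2 + (2 * V) ^ 2 / 3))|) := by
    rw [Real.log_rpow (by positivity), abs_mul,
      show |-(Module.finrank ℝ V3 : ℝ) / 2| = (Module.finrank ℝ V3 : ℝ) / 2 by
        rw [abs_div, abs_neg, abs_of_nonneg (Nat.cast_nonneg _), abs_of_pos two_pos]]
    exact mul_le_mul_of_nonneg_left (EntropyBudget.abs_log_between hh (EntropyBudget.h2_le_theta w x (hψ N))
      (EntropyBudget.theta_le w x (hψ N) hV)) (by positivity)
  -- the quadratic term, uniformly in the cell velocity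
  have hq : ‖v - cU N ψ w x‖ ^ 2 / (2 * h ^ 2) ≤ ‖v‖ ^ 2 / h ^ 2 + V ^ 2 / h ^ 2 := by
    have h1 : ‖v - cU N ψ w x‖ ^ 2 ≤ 2 * ‖v‖ ^ 2 + 2 * ‖cU N ψ w x‖ ^ 2 := by
      have h3 : ‖v - cU N ψ w x‖ ^ 2 ≤ (‖v‖ + ‖cU N ψ w x‖) ^ 2 :=
        pow_le_pow_left₀ (norm_nonneg _) (norm_sub_le v _) 2
      nlinarith only [h3, sq_nonneg (‖v‖ - ‖cU N ψ w x‖)]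
    have h2 : ‖cU N ψ w x‖ ^ 2 ≤ V ^ 2 :=
      pow_le_pow_left₀ (norm_nonneg _) (EntropyBudget.norm_cU_le w x (hψ N) hV) 2
    rw [← add_div, div_le_div_iff₀ (by positivity) (by positivity)]
    nlinarith [sq_nonneg h]
  linarith

/-- **Uniform envelope of the log-increment**: `|ΔΛ_x(y)| ≤ Λ + Σ_m ‖y_m‖²/h²` with `Λ ≥ 0` independent of `x`. -/
theorem exists_abs_dLam_le (hψ : ∀ N y, 0 ≤ ψ N y) {h : ℝ} (hh : 0 < h) {δ : ℝ} (hδ0 : 0 < δ) (hδ1 : δ ≤ 1)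
    (w : Cfg N) {V : ℝ} (hV : ∀ i, ‖(w i).2‖ ≤ V) :
    ∃ Λ : ℝ, 0 ≤ Λ ∧ ∀ (x : T3) (y : Quad), |dLam N ψ h δ w x y| ≤
      Λ + (‖y.1‖ ^ 2 + ‖y.2.1‖ ^ 2 + ‖y.2.2.1‖ ^ 2 + ‖y.2.2.2‖ ^ 2) / h ^ 2 := by
  obtain ⟨Λ, hΛ0, hΛ⟩ := exists_abs_log_cellLaw_le hψ hh hδ0 hδ1 w hV
  refine ⟨4 * Λ, by positivity, fun x y => ?_⟩
  have h1 := hΛ x y.2.2.1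
  have h2 := hΛ x y.2.2.2
  have h3 := hΛ x y.1
  have h4 := hΛ x y.2.1
  have t1 := abs_sub (Real.log (cellLaw N ψ h δ w x y.2.2.1) + Real.log (cellLaw N ψ h δ w x y.2.2.2) -
    Real.log (cellLaw N ψ h δ w x y.1)) (Real.log (cellLaw N ψ h δ w x y.2.1))
  have t2 := abs_sub (Real.log (cellLaw N ψ h δ w x y.2.2.1) + Real.log (cellLaw N ψ h δ w x y.2.2.2))
    (Real.log (cellLaw N ψ h δ w x y.1))
  have t3 := abs_add_le (Real.log (cellLaw N ψ h δ w x y.2.2.1)) (Real.log (cellLaw N ψ h δ w x y.2.2.2))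
  have e : (‖y.1‖ ^ 2 + ‖y.2.1‖ ^ 2 + ‖y.2.2.1‖ ^ 2 + ‖y.2.2.2‖ ^ 2) / h ^ 2 =
      ‖y.1‖ ^ 2 / h ^ 2 + ‖y.2.1‖ ^ 2 / h ^ 2 + ‖y.2.2.1‖ ^ 2 / h ^ 2 + ‖y.2.2.2‖ ^ 2 / h ^ 2 := by ring
  unfold dLam
  rw [e]
  linarith

/-- **Uniform bound on the tilting factor**: `e^{ΔΛ_x(y)/2} ≤ C · e^{α_x ‖y₁ − ū_x‖²} · e^{α_x ‖y₂ − ū_x‖²}` with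
`α_x = 1/(4(θ̄_x + h²))` and `C ≥ 0` independent of the location (the floor prefactor `(2π(θ̄_x + h²))^{-3/2}` is
bounded below uniformly since `θ̄_x ≤ (2V)²/3`). -/
theorem exists_exp_half_dLam_le (hψ : ∀ N y, 0 ≤ ψ N y) {h : ℝ} (hh : 0 < h) {δ : ℝ} (hδ0 : 0 < δ) (hδ1 : δ ≤ 1)
    (w : Cfg N) {V : ℝ} (hV : ∀ i, ‖(w i).2‖ ≤ V) :
    ∃ C : ℝ, 0 ≤ C ∧ ∀ (x : T3) (y : Quad), Real.exp (2⁻¹ * dLam N ψ h δ w x y) ≤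
      C * Real.exp ((4 * (cT N ψ w x + h ^ 2))⁻¹ * ‖y.1 - cU N ψ w x‖ ^ 2) *
        Real.exp ((4 * (cT N ψ w x + h ^ 2))⁻¹ * ‖y.2.1 - cU N ψ w x‖ ^ 2) := by
  set Θ : ℝ := h ^ 2 + (2 * V) ^ 2 / 3 with hΘ
  have hΘpos : 0 < Θ := by rw [hΘ]; positivity
  have hprefΘ : 0 < (2 * π * Θ) ^ (-(Module.finrank ℝ V3 : ℝ) / 2) := by positivity
  refine ⟨gauss h (0 : V3) 0 * (δ * (2 * π * Θ) ^ (-(Module.finrank ℝ V3 : ℝ) / 2))⁻¹,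
    mul_nonneg (DVTransfer.gauss_nonneg h 0 0) (by positivity), fun x y => ?_⟩
  have hτ : 0 < cT N ψ w x + h ^ 2 := EntropyBudget.theta_pos w x (hψ N) hh
  have hτΘ : cT N ψ w x + h ^ 2 ≤ Θ := EntropyBudget.theta_le w x (hψ N) hV
  have hpref : 0 < (2 * π * (cT N ψ w x + h ^ 2)) ^ (-(Module.finrank ℝ V3 : ℝ) / 2) := by positivity
  have h0 := DVTransfer.exp_half_dLam_le hψ hh.ne' hδ0 hδ1 w x y
  -- the prefactor comparison
  have hinv : (δ * (2 * π * (cT N ψ w x + h ^ 2)) ^ (-(Module.finrank ℝ V3 : ℝ) / 2))⁻¹ ≤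
      (δ * (2 * π * Θ) ^ (-(Module.finrank ℝ V3 : ℝ) / 2))⁻¹ := by
    refine inv_anti₀ (mul_pos hδ0 hprefΘ) (mul_le_mul_of_nonneg_left ?_ hδ0.le)
    exact Real.rpow_le_rpow_of_nonpos (by positivity) (mul_le_mul_of_nonneg_left hτΘ (by positivity))
      (div_nonpos_of_nonpos_of_nonneg (neg_nonpos.2 (Nat.cast_nonneg _)) zero_le_two)
  -- the Gaussian factor splits
  have esplit : Real.exp ((‖y.1 - cU N ψ w x‖ ^ 2 + ‖y.2.1 - cU N ψ w x‖ ^ 2) / (4 * (cT N ψ w x + h ^ 2))) =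
      Real.exp ((4 * (cT N ψ w x + h ^ 2))⁻¹ * ‖y.1 - cU N ψ w x‖ ^ 2) *
        Real.exp ((4 * (cT N ψ w x + h ^ 2))⁻¹ * ‖y.2.1 - cU N ψ w x‖ ^ 2) := by
    rw [← Real.exp_add]; congr 1; field_simp
  have hE : 0 ≤ Real.exp ((4 * (cT N ψ w x + h ^ 2))⁻¹ * ‖y.1 - cU N ψ w x‖ ^ 2) *
      Real.exp ((4 * (cT N ψ w x + h ^ 2))⁻¹ * ‖y.2.1 - cU N ψ w x‖ ^ 2) :=
    mul_nonneg (Real.exp_nonneg _) (Real.exp_nonneg _)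
  calc Real.exp (2⁻¹ * dLam N ψ h δ w x y)
      ≤ gauss h (0 : V3) 0 * (δ * (2 * π * (cT N ψ w x + h ^ 2)) ^ (-(Module.finrank ℝ V3 : ℝ) / 2))⁻¹ *
          Real.exp ((‖y.1 - cU N ψ w x‖ ^ 2 + ‖y.2.1 - cU N ψ w x‖ ^ 2) / (4 * (cT N ψ w x + h ^ 2))) := h0
    _ = gauss h (0 : V3) 0 * (δ * (2 * π * (cT N ψ w x + h ^ 2)) ^ (-(Module.finrank ℝ V3 : ℝ) / 2))⁻¹ *
          (Real.exp ((4 * (cT N ψ w x + h ^ 2))⁻¹ * ‖y.1 - cU N ψ w x‖ ^ 2) *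
            Real.exp ((4 * (cT N ψ w x + h ^ 2))⁻¹ * ‖y.2.1 - cU N ψ w x‖ ^ 2)) := by rw [esplit]
    _ ≤ gauss h (0 : V3) 0 * (δ * (2 * π * Θ) ^ (-(Module.finrank ℝ V3 : ℝ) / 2))⁻¹ *
          (Real.exp ((4 * (cT N ψ w x + h ^ 2))⁻¹ * ‖y.1 - cU N ψ w x‖ ^ 2) *
            Real.exp ((4 * (cT N ψ w x + h ^ 2))⁻¹ * ‖y.2.1 - cU N ψ w x‖ ^ 2)) :=
        mul_le_mul_of_nonneg_right (mul_le_mul_of_nonneg_left hinv (DVTransfer.gauss_nonneg h 0 0)) hE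
    _ = _ := by ring

/-! ## The smeared contact density from below -/

/-- A product mollifier centred at `c` is bounded below by an explicit Gaussian of `y` as soon as
`Σ_m ‖c_m‖² ≤ R²`: `G_h(0)⁴ e^{-(Σ_m ‖y_m‖² + R²)/h²} ≤ G_h^{⊗4}(y − c)` (`h ≠ 0`). -/
theorem gauss4_ge {h : ℝ} (hh : h ≠ 0) (c y : Quad) {R2 : ℝ}
    (hc : ‖c.1‖ ^ 2 + ‖c.2.1‖ ^ 2 + ‖c.2.2.1‖ ^ 2 + ‖c.2.2.2‖ ^ 2 ≤ R2) :
    gauss h (0 : V3) 0 ^ 4 * Real.exp (-((‖y.1‖ ^ 2 + ‖y.2.1‖ ^ 2 + ‖y.2.2.1‖ ^ 2 + ‖y.2.2.2‖ ^ 2 + R2) / h ^ 2)) ≤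
      gauss4 h c y := by
  have hh2 : 0 < h ^ 2 := pow_pos (abs_pos.2 hh) 2 |>.trans_eq (sq_abs h)
  have g0 : 0 ≤ gauss h (0 : V3) 0 := DVTransfer.gauss_nonneg h 0 0
  have b1 := DVTransfer.gauss_ge_of_norm_sq_le hh (le_refl (‖c.1‖ ^ 2)) y.1
  have b2 := DVTransfer.gauss_ge_of_norm_sq_le hh (le_refl (‖c.2.1‖ ^ 2)) y.2.1
  have b3 := DVTransfer.gauss_ge_of_norm_sq_le hh (le_refl (‖c.2.2.1‖ ^ 2)) y.2.2.1
  have b4 := DVTransfer.gauss_ge_of_norm_sq_le hh (le_refl (‖c.2.2.2‖ ^ 2)) y.2.2.2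
  set e1 := Real.exp (-((‖y.1‖ ^ 2 + ‖c.1‖ ^ 2) / h ^ 2)) with he1
  set e2 := Real.exp (-((‖y.2.1‖ ^ 2 + ‖c.2.1‖ ^ 2) / h ^ 2)) with he2
  set e3 := Real.exp (-((‖y.2.2.1‖ ^ 2 + ‖c.2.2.1‖ ^ 2) / h ^ 2)) with he3
  set e4 := Real.exp (-((‖y.2.2.2‖ ^ 2 + ‖c.2.2.2‖ ^ 2) / h ^ 2)) with he4
  have m1 : 0 ≤ gauss h (0 : V3) 0 * e1 := mul_nonneg g0 (Real.exp_nonneg _)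
  have m2 : 0 ≤ gauss h (0 : V3) 0 * e2 := mul_nonneg g0 (Real.exp_nonneg _)
  have m3 : 0 ≤ gauss h (0 : V3) 0 * e3 := mul_nonneg g0 (Real.exp_nonneg _)
  have m4 : 0 ≤ gauss h (0 : V3) 0 * e4 := mul_nonneg g0 (Real.exp_nonneg _)
  -- compare the exponents
  have hexp : Real.exp (-((‖y.1‖ ^ 2 + ‖y.2.1‖ ^ 2 + ‖y.2.2.1‖ ^ 2 + ‖y.2.2.2‖ ^ 2 + R2) / h ^ 2)) ≤
      e1 * e2 * e3 * e4 := by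
    rw [he1, he2, he3, he4, ← Real.exp_add, ← Real.exp_add, ← Real.exp_add]
    refine Real.exp_le_exp.2 ?_
    rw [← sub_nonneg]
    have e : -((‖y.1‖ ^ 2 + ‖c.1‖ ^ 2) / h ^ 2) + -((‖y.2.1‖ ^ 2 + ‖c.2.1‖ ^ 2) / h ^ 2) +
        -((‖y.2.2.1‖ ^ 2 + ‖c.2.2.1‖ ^ 2) / h ^ 2) + -((‖y.2.2.2‖ ^ 2 + ‖c.2.2.2‖ ^ 2) / h ^ 2) -
        -((‖y.1‖ ^ 2 + ‖y.2.1‖ ^ 2 + ‖y.2.2.1‖ ^ 2 + ‖y.2.2.2‖ ^ 2 + R2) / h ^ 2) =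
        (R2 - (‖c.1‖ ^ 2 + ‖c.2.1‖ ^ 2 + ‖c.2.2.1‖ ^ 2 + ‖c.2.2.2‖ ^ 2)) / h ^ 2 := by
      field_simp; ring
    rw [e]
    exact div_nonneg (sub_nonneg.2 hc) hh2.le
  calc gauss h (0 : V3) 0 ^ 4 *
        Real.exp (-((‖y.1‖ ^ 2 + ‖y.2.1‖ ^ 2 + ‖y.2.2.1‖ ^ 2 + ‖y.2.2.2‖ ^ 2 + R2) / h ^ 2))
      ≤ gauss h (0 : V3) 0 ^ 4 * (e1 * e2 * e3 * e4) := mul_le_mul_of_nonneg_left hexp (pow_nonneg g0 4)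
    _ = (gauss h (0 : V3) 0 * e1) * (gauss h (0 : V3) 0 * e2) * (gauss h (0 : V3) 0 * e3) *
          (gauss h (0 : V3) 0 * e4) := by ring
    _ ≤ gauss h c.1 y.1 * gauss h c.2.1 y.2.1 * gauss h c.2.2.1 y.2.2.1 * gauss h c.2.2.2 y.2.2.2 :=
        mul_le_mul (mul_le_mul (mul_le_mul b1 b2 m2 (m1.trans b1)) b3 m3
          (mul_nonneg (m1.trans b1) (m2.trans b2))) b4 m4
          (mul_nonneg (mul_nonneg (m1.trans b1) (m2.trans b2)) (m3.trans b3))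
    _ = gauss4 h c y := rfl

/-- **Floor of the smeared contact density**: if every contact quadruple `c` of the window has
`Σ_m ‖c_m‖² ≤ R²`, then `contactMass_x · G_h(0)⁴ e^{-(Σ_m ‖y_m‖² + R²)/h²} ≤ contactDens_x(y)`
(nonnegative kernel family, `h ≠ 0`; finitely many collisions in the window). -/
theorem contactDens_ge (hψ : ∀ N y, 0 ≤ ψ N y) {h : ℝ} (hh : h ≠ 0) (Φ : Flow σ N) (γc t : ℝ) (z : Cfg N) (k : ℕ)
    (x : T3)
    (hfin : (collisionTimes (Torus.geometry (Fin 3)) (hsDiameter σ N) (fun s => Φ.flow s z) ∩ win γc N t k).Finite)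
    (y : Quad) {R2 : ℝ}
    (hR2 : ∀ s ∈ hfin.toFinset, ∀ pp ∈ contactPairs (Torus.geometry (Fin 3)) (hsDiameter σ N) (Φ.flow s z),
      ‖(quadOf N (Φ.flow s z) pp.1 pp.2).1‖ ^ 2 + ‖(quadOf N (Φ.flow s z) pp.1 pp.2).2.1‖ ^ 2 +
        ‖(quadOf N (Φ.flow s z) pp.1 pp.2).2.2.1‖ ^ 2 + ‖(quadOf N (Φ.flow s z) pp.1 pp.2).2.2.2‖ ^ 2 ≤ R2) :
    contactMass σ N Φ ψ γc t z k x * (gauss h (0 : V3) 0 ^ 4 *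
      Real.exp (-((‖y.1‖ ^ 2 + ‖y.2.1‖ ^ 2 + ‖y.2.2.1‖ ^ 2 + ‖y.2.2.2‖ ^ 2 + R2) / h ^ 2))) ≤
      contactDens σ N Φ ψ γc h t z k x y := by
  rw [DVTransfer.contactMass_eq_sum Φ ψ γc t z k x hfin, DVTransfer.contactDens_eq_sum Φ ψ γc h t z k x hfin y,
    Finset.sum_mul]
  refine Finset.sum_le_sum fun s hs => ?_
  rw [Finset.sum_mul]
  exact Finset.sum_le_sum fun pp hpp => mul_le_mul_of_nonneg_left (gauss4_ge hh _ y (hR2 s hs pp hpp))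
    (DVTransfer.cw_nonneg hψ N _ x _)

/-- The contact quadruples of a window lie in a bounded set (finitely many collisions): there is `R² ≥ 0` with
`Σ_m ‖c_m‖² ≤ R²` for every contact quadruple `c` of the window. -/
theorem exists_quad_bound (Φ : Flow σ N) (γc t : ℝ) (z : Cfg N) (k : ℕ)
    (hfin : (collisionTimes (Torus.geometry (Fin 3)) (hsDiameter σ N) (fun s => Φ.flow s z) ∩ win γc N t k).Finite) :
    ∃ R2 : ℝ, 0 ≤ R2 ∧ ∀ s ∈ hfin.toFinset, ∀ pp ∈ contactPairs (Torus.geometry (Fin 3)) (hsDiameter σ N) (Φ.flow s z),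
      ‖(quadOf N (Φ.flow s z) pp.1 pp.2).1‖ ^ 2 + ‖(quadOf N (Φ.flow s z) pp.1 pp.2).2.1‖ ^ 2 +
        ‖(quadOf N (Φ.flow s z) pp.1 pp.2).2.2.1‖ ^ 2 + ‖(quadOf N (Φ.flow s z) pp.1 pp.2).2.2.2‖ ^ 2 ≤ R2 := by
  obtain ⟨Q, hQ⟩ : ∃ Q : ℝ → Fin (N + 1) × Fin (N + 1) → ℝ, ∀ s pp, Q s pp =
      ‖(quadOf N (Φ.flow s z) pp.1 pp.2).1‖ ^ 2 + ‖(quadOf N (Φ.flow s z) pp.1 pp.2).2.1‖ ^ 2 +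
        ‖(quadOf N (Φ.flow s z) pp.1 pp.2).2.2.1‖ ^ 2 + ‖(quadOf N (Φ.flow s z) pp.1 pp.2).2.2.2‖ ^ 2 :=
    ⟨_, fun _ _ => rfl⟩
  have hQ0 : ∀ s pp, 0 ≤ Q s pp := fun s pp => by rw [hQ]; positivity
  refine ⟨∑ s ∈ hfin.toFinset, ∑ pp ∈ contactPairs (Torus.geometry (Fin 3)) (hsDiameter σ N) (Φ.flow s z), Q s pp,
    Finset.sum_nonneg fun s _ => Finset.sum_nonneg fun pp _ => hQ0 s pp, fun s hs pp hpp => ?_⟩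
  rw [← hQ]
  refine le_trans ?_ (Finset.single_le_sum
    (f := fun s' => ∑ pp' ∈ contactPairs (Torus.geometry (Fin 3)) (hsDiameter σ N) (Φ.flow s' z), Q s' pp')
    (fun s' _ => Finset.sum_nonneg fun pp' _ => hQ0 s' pp') hs)
  exact Finset.single_le_sum (f := fun pp' => Q s pp') (fun pp' _ => hQ0 s pp') hpp

/-- A charged cell-window (`contactMass_x > 0`) has an everywhere positive smeared contact density. -/
theorem contactDens_pos (hψ : ∀ N y, 0 ≤ ψ N y) {h : ℝ} (hh : h ≠ 0) (Φ : Flow σ N) (γc t : ℝ) (z : Cfg N) (k : ℕ)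
    (x : T3)
    (hfin : (collisionTimes (Torus.geometry (Fin 3)) (hsDiameter σ N) (fun s => Φ.flow s z) ∩ win γc N t k).Finite)
    (hn : 0 < contactMass σ N Φ ψ γc t z k x) (y : Quad) : 0 < contactDens σ N Φ ψ γc h t z k x y := by
  obtain ⟨R2, -, hR2⟩ := exists_quad_bound Φ γc t z k hfin
  exact lt_of_lt_of_le (mul_pos hn (mul_pos (pow_pos (DVTransfer.gaussMax_pos hh) 4) (Real.exp_pos _)))
    (contactDens_ge hψ hh Φ γc t z k x hfin y hR2)

/-- **Uniform log-ratio envelope of the smeared contact density**: there is `M ≥ 0`, independent of the location,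
with `|log contactDens_x(y) − log contactMass_x| ≤ M + Σ_m ‖y_m‖²/h²` on every charged cell-window
(`contactMass_x G_h(0)⁴ e^{-(Σ‖y_m‖² + R²)/h²} ≤ contactDens_x(y) ≤ contactMass_x G_h(0)⁴`). -/
theorem exists_abs_log_contactDens_sub_le (hψ : ∀ N y, 0 ≤ ψ N y) {h : ℝ} (hh : h ≠ 0) (Φ : Flow σ N) (γc t : ℝ)
    {z : Cfg N} (hz : z ∈ Φ.good) (k : ℕ) :
    ∃ M : ℝ, 0 ≤ M ∧ ∀ (x : T3) (y : Quad), 0 < contactMass σ N Φ ψ γc t z k x →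
      |Real.log (contactDens σ N Φ ψ γc h t z k x y) - Real.log (contactMass σ N Φ ψ γc t z k x)| ≤
        M + (‖y.1‖ ^ 2 + ‖y.2.1‖ ^ 2 + ‖y.2.2.1‖ ^ 2 + ‖y.2.2.2‖ ^ 2) / h ^ 2 := by
  have hfin := DVTransfer.finite_collisionTimes_win Φ hz γc t k
  have hh2 : 0 < h ^ 2 := pow_pos (abs_pos.2 hh) 2 |>.trans_eq (sq_abs h)
  obtain ⟨R2, hR20, hR2⟩ := exists_quad_bound Φ γc t z k hfin
  obtain ⟨P, hP⟩ : ∃ P : ℝ, P = Real.log (gauss h (0 : V3) 0) := ⟨_, rfl⟩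
  have g0 : 0 < gauss h (0 : V3) 0 := DVTransfer.gaussMax_pos hh
  refine ⟨8 * |P| + R2 / h ^ 2, by positivity, fun x y hn => ?_⟩
  obtain ⟨qn, hqn⟩ : ∃ q : ℝ, q = ‖y.1‖ ^ 2 + ‖y.2.1‖ ^ 2 + ‖y.2.2.1‖ ^ 2 + ‖y.2.2.2‖ ^ 2 := ⟨_, rfl⟩
  have hqn0 : 0 ≤ qn := by rw [hqn]; positivity
  have hlow := contactDens_ge hψ hh Φ γc t z k x hfin y hR2
  have hup := DVTransfer.contactDens_le hψ Φ γc h t z k x hfin y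
  have hp : 0 < contactDens σ N Φ ψ γc h t z k x y := contactDens_pos hψ hh Φ γc t z k x hfin hn y
  rw [← hqn] at hlow ⊢
  -- the ratio `p / n` lies in `[G0⁴ e^{-(qn + R2)/h²}, G0⁴]`
  have ha : 0 < gauss h (0 : V3) 0 ^ 4 * Real.exp (-((qn + R2) / h ^ 2)) := mul_pos (pow_pos g0 4) (Real.exp_pos _)
  have hlow' : gauss h (0 : V3) 0 ^ 4 * Real.exp (-((qn + R2) / h ^ 2)) ≤
      contactDens σ N Φ ψ γc h t z k x y / contactMass σ N Φ ψ γc t z k x := by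
    rw [le_div_iff₀ hn, mul_comm]; exact hlow
  have hup' : contactDens σ N Φ ψ γc h t z k x y / contactMass σ N Φ ψ γc t z k x ≤ gauss h (0 : V3) 0 ^ 4 := by
    rw [div_le_iff₀ hn, mul_comm]; exact hup
  have hb := DVTransfer.abs_log_le_of_mem ha hlow' hup'
  rw [Real.log_div hp.ne' hn.ne'] at hb
  have e1 : Real.log (gauss h (0 : V3) 0 ^ 4 * Real.exp (-((qn + R2) / h ^ 2))) = 4 * P - (qn + R2) / h ^ 2 := by
    rw [Real.log_mul (pow_pos g0 4).ne' (Real.exp_pos _).ne', Real.log_exp, Real.log_pow, hP]; push_cast; ring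
  have e2 : Real.log (gauss h (0 : V3) 0 ^ 4) = 4 * P := by rw [Real.log_pow, hP]; push_cast; ring
  rw [e1, e2] at hb
  have hqR : 0 ≤ (qn + R2) / h ^ 2 := by positivity
  have t1 : |4 * P - (qn + R2) / h ^ 2| ≤ 4 * |P| + (qn + R2) / h ^ 2 := by
    rw [abs_le]
    have := neg_abs_le P
    have := le_abs_self P
    constructor <;> linarith
  have t2 : |4 * P| = 4 * |P| := by rw [abs_mul, abs_of_pos (by norm_num : (0 : ℝ) < 4)]
  have e3 : (qn + R2) / h ^ 2 = qn / h ^ 2 + R2 / h ^ 2 := add_div _ _ _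
  linarith

end DVAggregate

/-! ## Registered anchor of this support file -/

/-- ANCHOR (registered helper stub `bhDVAggregate_envelope_anchor` of the crux item): the uniform log-envelope of
the regularised cell law — for a nonnegative kernel family, `0 < h`, `0 < δ ≤ 1` and a configuration with speeds
`≤ V`, there is `Λ ≥ 0` with `|log cellLaw_x(v)| ≤ Λ + ‖v‖²/h²` for every location `x` and velocity `v`. -/
theorem bhDVAggregate_envelope_anchor : ∀ (N : ℕ) (ψ : ℕ → T3 → ℝ), (∀ N y, 0 ≤ ψ N y) → ∀ (h : ℝ), 0 < h → ∀ (δ : ℝ), 0 < δ → δ ≤ 1 → ∀ (w : Cfg N) (V : ℝ), (∀ i, ‖(w i).2‖ ≤ V) → ∃ Λ : ℝ, 0 ≤ Λ ∧ ∀ (x : T3) (v : V3), |Real.log (cellLaw N ψ h δ w x v)| ≤ Λ + ‖v‖ ^ 2 / h ^ 2 :=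
  fun _ _ hψ _ hh _ hδ0 hδ1 w _ hV => DVAggregate.exists_abs_log_cellLaw_le hψ hh hδ0 hδ1 w hV

end

end Summit.AtomisticToContinuum.HydrodynamicLimit.Theorems.BlockHDissipation
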